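import Summits.NavierStokesRegularity.NavierStokesRegularity.Theorems.SoloSalvageLin2013Maximal
import Literature.Analysis.FluidPDE.PeriodicBoxTorus
import HarnessLib

/-!
# Bridge «a-priori enstrophy bound for all classical periodic solutions ⇒ Clay (B)»

Periodic companion (solo lane file name `SoloSalvageLin2013ClayBBridge.lean`, namespace `StrongHypotheses`) of the `Theorems/StrongHypotheses*Bridge.lean` files (sup bound p463996, BKM bound
p467459, `L³` / `Ḣ^{1/2}` / `H^{1/2}` bounds): the ENSTROPHY-type strong hypothesis in the periodic
setting — «every classical ℤ³-periodic solution of the unforced Navier–Stokes system on `ℝ³ × [0,T)`,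
`ν > 0`, has `sup_{t<T} ∫_{[0,1)³} |curl u(t)|² < ∞`» — implies Fefferman's periodic statement (B), in the
CMI-errata form `ClayVariants.clayPeriodicErrata.Regularity` (velocity AND pressure periodic) and hence
in the printed form `ClayVariants.clayPeriodic.Regularity`. Claimed regularity proofs of the periodic
a-priori family (cell `ns-claims`, D-0090: C21 `Lin2013` Step 6, C22 `Chaabani2020`, C13b `Kampen2015`)
compose with (B) through exactly this implication; it is CLASSICAL (Robinson–Rodrigo–Sadowski 2016,
§6.3 and Lemma 6.11: the maximal strong solution on `𝕋³` blows up in `H¹` or is global) and is landed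
here in the kernel over theorems of the tree:

* the periodic local theory with the maximal alternative on `ℝ³`,
  `Lin2013Salvage.lin2013_step1_holds` (from `Torus.exists_maximal_classicalNS`, RRS §6.3/§8.1, through
  the ℝ³ ⇄ 𝕋³ bridge of `SoloSalvageLin2013(Maximal).lean`);
* continuation past `T` from an enstrophy bound, `Lin2013Salvage.lin2013_step2_holds` (the enstrophy door
  `Torus.classicalNS_continuation_of_gradNormSq_le`, RRS Lemma 6.11, after Galilean removal of the mean).

The hypothesis is an explicit binder (no new definition); it is OPEN — only the implication is asserted.
No `Theses` import (route-independent).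

WHAT THIS IS NOT: not a claim about NS regularity or blow-up; not a claim about any author beyond the typed
locator.

## References

* J. C. Robinson, J. L. Rodrigo, W. Sadowski, *The three-dimensional Navier–Stokes equations*, CUP 2016,
  §6.3 p.108, §8.1 p.122, Lemma 6.11. [`RobinsonRodrigoSadowskiCUP2016`]
* C. L. Fefferman, *Existence and smoothness of the Navier–Stokes equation* (CMI 2006), (B), (8), (10), (11)
  and the errata sentence on the pressure. [`FeffermanClay2006`]
-/

noncomputable section

namespace Summit.NavierStokesRegularity.StrongHypotheses

open Set MeasureTheory
open Literature.Analysis.FluidPDE Literature.Analysis.FunctionSpaces Literature.Claims.NS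
open Summit.NavierStokesRegularity.NavierStokesRegularity.Theorems.Lin2013Salvage

/-- **A-priori enstrophy bound for all classical periodic solutions ⇒ Clay (B), errata form.** If every
classical solution of the unforced Navier–Stokes system on `ℝ³ × [0,T)` (`ν > 0`, `T > 0`) with
ℤ³-periodic velocity and pressure slices has its enstrophy per period cell `∫_{[0,1)³}|curl u(t)|²`
bounded on `[0,T)`, then for every smooth divergence-free periodic datum there is a global classical
periodic solution (`ClayVariants.clayPeriodicErrata.Regularity`): the maximal alternative
(`lin2013_step1_holds`) leaves either a global solution or a maximal one on `[0,T*)`, and the latter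
would continue past `T*` by the enstrophy door (`lin2013_step2_holds`) — contradiction.
[cite: RobinsonRodrigoSadowskiCUP2016, §6.3 p. 108 with Lemma 6.11] -/
theorem clayPeriodicErrata_regularity_of_periodicEnstrophyBound
    (H : ∀ (ν T : ℝ), 0 < ν → 0 < T →
      ∀ (u : ℝ → EuclideanSpace ℝ (Fin 3) → EuclideanSpace ℝ (Fin 3))
        (p : ℝ → EuclideanSpace ℝ (Fin 3) → ℝ), IsClassicalNSSolutionOn (Ico 0 T) ν 0 u p →
        (∀ t ∈ Ico 0 T, IsLatticePeriodic (u t) ∧ IsLatticePeriodic (p t)) →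
        ∃ M : ℝ, ∀ t ∈ Ico 0 T, ∫ x in Torus.unitCube (Fin 3), ‖curl (u t) x‖ ^ 2 ≤ M) :
    ClayVariants.clayPeriodicErrata.Regularity := by
  intro ν hν u₀ hu₀ hdiv hper
  rcases lin2013_step1_holds ν hν u₀ hu₀ hdiv hper with ⟨u, p, hsol, h0⟩ | ⟨T, hT, u, p, hsol, -, hmax⟩
  · exact ⟨u, p, hsol.1.smooth_velocity, hsol.1.smooth_pressure,
      ⟨fun t ht x => hsol.1.momentum t ht x, fun t ht => hsol.1.divFree t ht, h0⟩,
      fun t ht => hsol.2 t ht⟩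
  · exfalso
    obtain ⟨M, hM⟩ := H ν T hν hT u p hsol.1 hsol.2
    refine hmax (lin2013_step2_holds ν hν T hT u p hsol ⟨M, fun t ht => ?_⟩)
    -- the cell `(0,1)³` of the claim file and the fundamental domain `[0,1)³` differ by a null set
    have hcell : Lin2013.cellSq (curl (u t)) = ∫ x in Torus.unitCube (Fin 3), ‖curl (u t) x‖ ^ 2 := by
      unfold Lin2013.cellSq
      rw [cell_eq_openCube, setIntegral_congr_set PeriodicCylinder.openCube_ae_eq_unitCube]
    rw [hcell]
    exact hM t ht

/-- **The same hypothesis implies the PRINTED Clay (B)** (`ClayVariants.clayPeriodic.Regularity`, pressure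
periodicity not required in the conclusion): the errata form implies the printed one
(`Lin2013.clayB_of_claimed`). [cite: FeffermanClay2006, statement (B) with (8), (10), (11)] -/
theorem clayPeriodic_regularity_of_periodicEnstrophyBound
    (H : ∀ (ν T : ℝ), 0 < ν → 0 < T →
      ∀ (u : ℝ → EuclideanSpace ℝ (Fin 3) → EuclideanSpace ℝ (Fin 3))
        (p : ℝ → EuclideanSpace ℝ (Fin 3) → ℝ), IsClassicalNSSolutionOn (Ico 0 T) ν 0 u p →
        (∀ t ∈ Ico 0 T, IsLatticePeriodic (u t) ∧ IsLatticePeriodic (p t)) →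
        ∃ M : ℝ, ∀ t ∈ Ico 0 T, ∫ x in Torus.unitCube (Fin 3), ‖curl (u t) x‖ ^ 2 ≤ M) :
    ClayVariants.clayPeriodic.Regularity :=
  Lin2013.clayB_of_claimed (clayPeriodicErrata_regularity_of_periodicEnstrophyBound H)

end Summit.NavierStokesRegularity.StrongHypotheses

end
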